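import Mathlib
import Summits.KontsevichZagierPeriods.KontsevichZagierPeriods.Theorems.SoloInformedKummerBisection
import Summits.KontsevichZagierPeriods.KontsevichZagierPeriods.Theorems.SoloInformedReflectionChains
import HarnessLib
import HarnessLib.Audit

/-!
# Kummer family III: the pole-parameter involution `n ↦ (m−n)/(1−n)` is ONE move (s40)

THEOREM XXVIII(c) of the residency paper (§6quattuordecies), in the strengthened form found while
typing it.  Let `0 < m < 1` be a real algebraic squared modulus, `f(x) = ((1−x²)(1−mx²))^{-1/2}`
on `(0,1)`, and for a real algebraic POLE PARAMETER `n < 1` let `Π_n = [(0,1), f/(1−nx²)]` (the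
complete elliptic integral of the third kind `Π(n | m)`; absolutely convergent exactly for
`n < 1`, `Π_0 = K`) and `Q_n = [(0,1), f·(1−mx²)/(1−nx²)]` (`Q_0 = E`).  The map
`n ↦ N = (m−n)/(1−n)` is an INVOLUTION of `(−∞,1)` exchanging `(−∞,0)` with `(m,1)` and reversing
`(0,m)` about its fixed point `n = 1 − √(1−m)`.  Then, in the Kontsevich–Zagier period ring `P`,
  `⟦[pt, 1−m]⟧·⟦Π_N⟧ = ⟦[pt, 1−n]⟧·⟦Q_n⟧`                                    (move form)
by ONE MOVE of rule (2): the semialgebraic involution `τ(x) = √(1−x²)/√(1−mx²)` of `(0,1)` — the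
involution of files I–II with `k'² ↦ m`; on the curve `y² = (1−x²)(1−mx²)` it is translation by
the 2-torsion point over `x = 1` composed with `[−1]` — has `f(τ)|τ'| = f` and carries the pole
divisor `x² = 1/N` to `x² = 1/n`:  `1 − Nτ(x)² = ((1−m)/(1−n))·(1−nx²)/(1−mx²)`.  Rule (1b), the
partial fraction `(1−mx²)/(1−nx²) = m/n + (1−m/n)/(1−nx²)`, then gives for `n ≠ 0`
  `⟦[pt,1−m]⟧·⟦Π_N⟧ = ⟦[pt,1−n]⟧·(⟦[pt, m/n]⟧·⟦K⟧ + ⟦[pt, 1−m/n]⟧·⟦Π_n⟧)`,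
which for `n < 0` is the law `(1−m)Π(N) = (1−n)[(m/n)K + (1−m/n)Π(n)]` reducing the negative
parameters to the circular band [AS64, 17.7.15–17.7.17] — so THEOREM XXVIII (the third-kind
reciprocity law along the Kummer family, proved on the bands `0 < n < m`, `m < n < 1`) covers
every real algebraic `n < 1`.  Two classical special values drop out as ONE-MOVE identities:
at the cusp `n = 0` (`N = m`, poles at the branch points `x = ±1/√m`) the move form IS
`(1−m)·Π(m | m) = E(m)` [AS64, 17.7.24], a third-kind period equal to a second-kind one; and at the
FIXED POINT `n = N = 1 − √(1−m)` (pole point = the real 4-torsion point `u₀ = K/2`,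
`sn²(K/2) = 1/(1+k')`) the two displayed identities solve to
`2√(1−m)·Π(1−√(1−m) | m) = (1+√(1−m))·K(m)` [AS64, 17.7.23 at `φ = π/2`] — the `π`-FREE
hyperbolic twin of THEOREM XXIV (`n = k`, `u₀ = K + iK'/2`), again with no input beyond the rules.

References: A. M. Legendre, Traité des fonctions elliptiques I (1825), ch. XXIII; M. Abramowitz –
I. Stegun, Handbook of Mathematical Functions (1964), §17.7 (17.7.15–17.7.25); D. F. Lawden,
Elliptic Functions and Applications (1989), §3.8; M. Kontsevich – D. Zagier, Periods (2001), §1.2;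
this work.
-/

noncomputable section

open MeasureTheory Set Filter
open scoped Classical

open Literature.NumberTheory.Transcendental Literature.NumberTheory.Transcendental.KZ
open Literature.ModelTheory.ExponentialFields

namespace Summit.KontsevichZagierPeriods.KontsevichZagierPeriods.Theorems

/-! ### The complementary modulus; the involution on the whole interval `(0,1)` -/

/-- For `m ∈ (0,1)` algebraic, `k = √(1−m)` is algebraic, lies in `(0,1)`, and `1 − k² = m`.
[folklore] -/
theorem soloInformed_exists_complementaryModulus {m : ℝ} (hm : m ∈ Ioo (0:ℝ) 1)
    (hma : IsAlgebraic ℚ m) : ∃ k : ℝ, k ∈ Ioo (0:ℝ) 1 ∧ IsAlgebraic ℚ k ∧ 1 - k ^ 2 = m := by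
  have h1 : 0 < 1 - m := by linarith [hm.2]
  refine ⟨√(1 - m), ⟨Real.sqrt_pos.2 h1, (Real.sqrt_lt' one_pos).2 (by linarith [hm.1])⟩, ?_, ?_⟩
  · exact IsAlgebraic.of_pow two_pos (by rw [Real.sq_sqrt h1.le]; exact isAlgebraic_one.sub hma)
  · rw [Real.sq_sqrt h1.le]
    ring

/-- The involution maps `(0,1)` into itself. [this work] -/
theorem soloInformed_bisection_involution_mem_Ioo {k t : ℝ} (hk : k ∈ Ioo (0:ℝ) 1)
    (ht : t ∈ Ioo (0:ℝ) 1) : √(1 - t ^ 2) / √(1 - (1 - k ^ 2) * t ^ 2) ∈ Ioo (0:ℝ) 1 := by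
  have hu0 : 0 < 1 - t ^ 2 := by nlinarith [ht.1, ht.2]
  have hv0 : 0 < 1 - (1 - k ^ 2) * t ^ 2 := soloInformed_legendre_radicand_pos' ht (sq_nonneg k)
  have hV0 : 0 < √(1 - (1 - k ^ 2) * t ^ 2) := Real.sqrt_pos.2 hv0
  refine ⟨div_pos (Real.sqrt_pos.2 hu0) hV0, (div_lt_one hV0).2 ?_⟩
  exact Real.sqrt_lt_sqrt hu0.le (by nlinarith [mul_pos (pow_pos hk.1 2) (pow_pos ht.1 2)])

/-- `τ ∘ τ = id` on `(0,1)`: the move is an involution. [this work] -/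
theorem soloInformed_bisection_involution_invol {k t : ℝ} (hk : k ∈ Ioo (0:ℝ) 1)
    (ht : t ∈ Ioo (0:ℝ) 1) :
    √(1 - (√(1 - t ^ 2) / √(1 - (1 - k ^ 2) * t ^ 2)) ^ 2) /
        √(1 - (1 - k ^ 2) * (√(1 - t ^ 2) / √(1 - (1 - k ^ 2) * t ^ 2)) ^ 2) = t := by
  have hv0 : 0 < 1 - (1 - k ^ 2) * t ^ 2 := soloInformed_legendre_radicand_pos' ht (sq_nonneg k)
  obtain ⟨h1, h2⟩ := soloInformed_bisection_involution_sq (k := k) ht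
  rw [h1, h2, Real.sqrt_div' _ hv0.le, Real.sqrt_div' _ hv0.le,
    Real.sqrt_sq (mul_pos hk.1 ht.1).le, Real.sqrt_sq hk.1.le]
  rw [div_div_div_cancel_right₀ (Real.sqrt_pos.2 hv0).ne', mul_div_cancel_left₀ _ hk.1.ne']

/-- The involution maps `(0,1)` ONTO `(0,1)`. [this work] -/
theorem soloInformed_bisection_involution_image_Ioo {k : ℝ} (hk : k ∈ Ioo (0:ℝ) 1) :
    (fun t : ℝ => √(1 - t ^ 2) / √(1 - (1 - k ^ 2) * t ^ 2)) '' Ioo (0:ℝ) 1 = Ioo (0:ℝ) 1 := by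
  refine Subset.antisymm ?_ fun y hy => ?_
  · rintro _ ⟨t, ht, rfl⟩
    exact soloInformed_bisection_involution_mem_Ioo hk ht
  · exact ⟨_, soloInformed_bisection_involution_mem_Ioo hk hy,
      soloInformed_bisection_involution_invol hk hy⟩

/-- The lifted involution is `ℚ`-semialgebraic on the slab `(0,1)` (`k` algebraic). [this work] -/
theorem soloInformed_bisection_involution_sa_Ioo {k : ℝ} (hk : k ∈ Ioo (0:ℝ) 1)
    (hka : IsAlgebraic ℚ k) :
    IsSemialgebraicMapOn ℚ {x : Fin 1 → ℝ | x 0 ∈ Ioo (0:ℝ) 1}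
      (soloInformedLift fun t : ℝ => √(1 - t ^ 2) / √(1 - (1 - k ^ 2) * t ^ 2)) := by
  have hLo := BallPeeling.isSemialgebraic_posIoo
  have h1 : IsSemialgebraicFunOn ℚ {x : Fin 1 → ℝ | x 0 ∈ Ioo (0:ℝ) 1}
      (fun x : Fin 1 → ℝ => 1 - x 0 ^ 2) := by
    refine ((isSemialgebraicFunOn_const_of_isAlgebraic hLo isAlgebraic_one).sub_holds
      (isSemialgebraicFunOn_aeval hLo (MvPolynomial.X 0 ^ 2))).congr fun x _ => ?_
    simp only [Pi.sub_apply, map_pow, MvPolynomial.aeval_X]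
  have hm : 1 - k ^ 2 ∈ Ioo (0:ℝ) 1 := ⟨by nlinarith [hk.1, hk.2], by nlinarith [hk.1, hk.2]⟩
  obtain ⟨-, h2⟩ := soloInformed_sa_modulusFactors hm (isAlgebraic_one.sub (hka.pow 2))
  refine IsSemialgebraicMapOn.of_forall hLo fun j => ?_
  refine ((IsSemialgebraicFunOn.sqrt_holds h1).mul_holds h2).congr fun x _ => ?_
  simp only [Pi.mul_apply, soloInformedLift, div_eq_mul_inv]

/-! ### The pole factor under the involution -/

/-- `0 < 1 − n s²` on `(0,1)` for every `n < 1`. [folklore] -/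
theorem soloInformed_poleFactor_pos {s n : ℝ} (hs : s ∈ Ioo (0:ℝ) 1) (hn : n < 1) :
    0 < 1 - n * s ^ 2 := (soloInformed_legendre_radicand_pos hs hn).2

/-- Under the involution the pole factor of parameter `N = (m−n)/(1−n)` becomes that of parameter
`n`:  `1 − N·τ² = ((1−m)/(1−n))·(1−nt²)/(1−mt²)`  (`m = 1 − k²`). [this work] -/
theorem soloInformed_kummer_involution_poleFactor {k t n : ℝ} (ht : t ∈ Ioo (0:ℝ) 1)
    (hn : n < 1) :
    1 - (1 - k ^ 2 - n) / (1 - n) * (√(1 - t ^ 2) / √(1 - (1 - k ^ 2) * t ^ 2)) ^ 2 =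
      (1 - (1 - k ^ 2)) / (1 - n) * ((1 - n * t ^ 2) / (1 - (1 - k ^ 2) * t ^ 2)) := by
  have hu0 : 0 < 1 - t ^ 2 := by nlinarith [ht.1, ht.2]
  have hv0 : 0 < 1 - (1 - k ^ 2) * t ^ 2 := soloInformed_legendre_radicand_pos' ht (sq_nonneg k)
  have hn' : (1:ℝ) - n ≠ 0 := by linarith
  have hv : 1 - (1 - k ^ 2) * t ^ 2 ≠ 0 := hv0.ne'
  rw [div_pow, Real.sq_sqrt hu0.le, Real.sq_sqrt hv0.le]
  field_simp
  ring

/-- **The Jacobian identity of the move**: for `t ∈ (0,1)`,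
`((1−n)/(1−m))·(1−mt²)/(1−nt²)·f(t) = p_N(τ(t))·|τ'(t)|`, `p_N = f/(1−Nx²)`. [this work] -/
theorem soloInformed_kummer_involution_jacobian {k t n : ℝ} (hk : k ∈ Ioo (0:ℝ) 1)
    (ht : t ∈ Ioo (0:ℝ) 1) (hn : n < 1) :
    (1 - n) / (1 - (1 - k ^ 2)) * ((1 - (1 - k ^ 2) * t ^ 2) / (1 - n * t ^ 2)) *
        ((√(1 - t ^ 2))⁻¹ * (√(1 - (1 - k ^ 2) * t ^ 2))⁻¹) =
      (1 - (1 - k ^ 2 - n) / (1 - n) * (√(1 - t ^ 2) / √(1 - (1 - k ^ 2) * t ^ 2)) ^ 2)⁻¹ *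
          ((√(1 - (√(1 - t ^ 2) / √(1 - (1 - k ^ 2) * t ^ 2)) ^ 2))⁻¹ *
            (√(1 - (1 - k ^ 2) * (√(1 - t ^ 2) / √(1 - (1 - k ^ 2) * t ^ 2)) ^ 2))⁻¹) *
        |-(k ^ 2 * t) * ((√(1 - t ^ 2))⁻¹ * (√(1 - (1 - k ^ 2) * t ^ 2))⁻¹) /
          (1 - (1 - k ^ 2) * t ^ 2)| := by
  have hv0 : 0 < 1 - (1 - k ^ 2) * t ^ 2 := soloInformed_legendre_radicand_pos' ht (sq_nonneg k)
  have hp0 : 0 < 1 - n * t ^ 2 := soloInformed_poleFactor_pos ht hn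
  have hn' : (1:ℝ) - n ≠ 0 := by linarith
  have hk2 : (1:ℝ) - (1 - k ^ 2) ≠ 0 := by nlinarith [hk.1]
  have hv := hv0.ne'
  have hp := hp0.ne'
  rw [soloInformed_kummer_involution_poleFactor ht hn, mul_assoc (((1 - (1 - k ^ 2)) / (1 - n) *
    ((1 - n * t ^ 2) / (1 - (1 - k ^ 2) * t ^ 2)))⁻¹), ← soloInformed_bisection_jacobian hk ht]
  field_simp

/-! ### Representations: bounded multipliers, `Π_n` and `Q_n` for every `n < 1` -/

/-- A bounded `ℚ`-semialgebraic multiplier of the integrand of a representation gives a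
representation on the same domain. [this work] -/
theorem soloInformed_exists_rep_mul_bounded (P : IntegralRep 1) (φ : (Fin 1 → ℝ) → ℝ) (C : ℝ)
    (hφ : IsSemialgebraicFunOn ℚ P.domain φ) (hC : ∀ x ∈ P.domain, |φ x| ≤ C) :
    ∃ R : IntegralRep 1, R.domain = P.domain ∧ ∀ x, R.integrand x = φ x * P.integrand x := by
  have hmeas : MeasurableSet P.domain :=
    IsSemialgebraic.measurableSet_holds P.isSemialgebraic_domain
  have hsa : IsSemialgebraicFunOn ℚ P.domain (fun x => φ x * P.integrand x) :=
    (hφ.mul_holds P.isSemialgebraicFunOn_integrand).congr fun x _ => by simp only [Pi.mul_apply]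
  have hint : IntegrableOn (fun x => φ x * P.integrand x) P.domain := by
    refine Integrable.mono' (P.integrableOn.norm.const_mul C)
      (aestronglyMeasurable_of_isSemialgebraicFunOn hsa hmeas)
      ((ae_restrict_iff' hmeas).2 (ae_of_all _ fun x hx => ?_))
    rw [norm_mul, Real.norm_eq_abs]
    exact mul_le_mul_of_nonneg_right (hC x hx) (norm_nonneg _)
  exact ⟨⟨_, _, P.isSemialgebraic_domain, hsa, hint⟩, rfl, fun _ => rfl⟩

/-- `x ↦ 1 − n x²` and `x ↦ (1 − n x²)⁻¹` are `ℚ`-semialgebraic on `(0,1)` for algebraic `n < 1`,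
and `|(1 − n x²)⁻¹| ≤ 1 + (1−n)⁻¹` there. [folklore] -/
theorem soloInformed_sa_poleFactor {n : ℝ} (hna : IsAlgebraic ℚ n) (hn : n < 1) :
    IsSemialgebraicFunOn ℚ {x : Fin 1 → ℝ | x 0 ∈ Ioo (0:ℝ) 1}
        (fun x : Fin 1 → ℝ => (1 - n * x 0 ^ 2)⁻¹) ∧
      ∀ x ∈ {x : Fin 1 → ℝ | x 0 ∈ Ioo (0:ℝ) 1}, |(1 - n * x 0 ^ 2)⁻¹| ≤ 1 + (1 - n)⁻¹ := by
  have hsq := BallPeeling.isSemialgebraic_posIoo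
  have hlin : IsSemialgebraicFunOn ℚ {x : Fin 1 → ℝ | x 0 ∈ Ioo (0:ℝ) 1}
      (fun x : Fin 1 → ℝ => 1 - n * x 0 ^ 2) := by
    refine ((isSemialgebraicFunOn_const_of_isAlgebraic hsq isAlgebraic_one).sub_holds
      ((isSemialgebraicFunOn_const_of_isAlgebraic hsq hna).mul_holds
        (isSemialgebraicFunOn_aeval hsq (MvPolynomial.X 0 ^ 2)))).congr fun x _ => ?_
    simp only [Pi.sub_apply, Pi.mul_apply, map_pow, MvPolynomial.aeval_X]
  refine ⟨hlin.inv fun x hx => (soloInformed_poleFactor_pos hx hn).ne', fun x hx => ?_⟩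
  have hx : x 0 ∈ Ioo (0:ℝ) 1 := hx
  have hp := soloInformed_poleFactor_pos hx hn
  have h1n : 0 < (1 - n)⁻¹ := inv_pos.2 (by linarith)
  rw [abs_of_pos (inv_pos.2 hp)]
  rcases le_or_gt n 0 with h | h
  · have h1 : 1 ≤ 1 - n * x 0 ^ 2 := by nlinarith [sq_nonneg (x 0)]
    calc (1 - n * x 0 ^ 2)⁻¹ ≤ 1 := inv_le_one_of_one_le₀ h1
      _ ≤ 1 + (1 - n)⁻¹ := by linarith
  · have hs2 : x 0 ^ 2 ≤ 1 := by nlinarith [hx.1, hx.2]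
    have h1 : 1 - n ≤ 1 - n * x 0 ^ 2 := by nlinarith
    calc (1 - n * x 0 ^ 2)⁻¹ ≤ (1 - n)⁻¹ := inv_anti₀ (by linarith) h1
      _ ≤ 1 + (1 - n)⁻¹ := by linarith

/-- **The third-kind representation for EVERY pole parameter `n < 1`**: for algebraic `n < 1`,
`m ∈ (0,1)` there is `Π_n = [(0,1), (1−nx²)^{-1}((1−x²)(1−mx²))^{-1/2}]`. [this work] -/
theorem soloInformed_exists_ellipticPi_rep_of_lt_one (n m : ℝ) (hn : n < 1)
    (hna : IsAlgebraic ℚ n) (hm : m ∈ Ioo (0:ℝ) 1) (hma : IsAlgebraic ℚ m) :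
    ∃ P : IntegralRep 1, P.domain = {x : Fin 1 → ℝ | x 0 ∈ Ioo (0:ℝ) 1} ∧
      ∀ x, P.integrand x = (1 - n * x 0 ^ 2)⁻¹ *
        ((√(1 - x 0 ^ 2))⁻¹ * (√(1 - m * x 0 ^ 2))⁻¹) := by
  obtain ⟨K, hKd, hKi⟩ := soloInformed_exists_ellipticK_rep m hm hma
  obtain ⟨hsa, hbd⟩ := soloInformed_sa_poleFactor hna hn
  rw [← hKd] at hsa hbd
  obtain ⟨P, hPd, hPi⟩ := soloInformed_exists_rep_mul_bounded K _ _ hsa hbd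
  exact ⟨P, hPd.trans hKd, fun x => by rw [hPi, hKi]⟩

/-- **The transported representation `Q_n = [(0,1), (1−mx²)(1−nx²)^{-1}((1−x²)(1−mx²))^{-1/2}]`**
(`n < 1` algebraic; `Q_0 = E`). [this work] -/
theorem soloInformed_exists_kummerQ_rep (n m : ℝ) (hn : n < 1) (hna : IsAlgebraic ℚ n)
    (hm : m ∈ Ioo (0:ℝ) 1) (hma : IsAlgebraic ℚ m) :
    ∃ Q : IntegralRep 1, Q.domain = {x : Fin 1 → ℝ | x 0 ∈ Ioo (0:ℝ) 1} ∧
      ∀ x, Q.integrand x = (1 - m * x 0 ^ 2) / (1 - n * x 0 ^ 2) *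
        ((√(1 - x 0 ^ 2))⁻¹ * (√(1 - m * x 0 ^ 2))⁻¹) := by
  obtain ⟨K, hKd, hKi⟩ := soloInformed_exists_ellipticK_rep m hm hma
  obtain ⟨hsa, hbd⟩ := soloInformed_sa_poleFactor hna hn
  have hφ : IsSemialgebraicFunOn ℚ K.domain
      (fun x : Fin 1 → ℝ => (1 - m * x 0 ^ 2) / (1 - n * x 0 ^ 2)) := by
    rw [hKd]
    exact ((soloInformed_sa_modulusFactors hm hma).1.mul_holds hsa).congr fun x _ => by
      simp only [Pi.mul_apply, div_eq_mul_inv]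
  have hC : ∀ x ∈ K.domain, |(1 - m * x 0 ^ 2) / (1 - n * x 0 ^ 2)| ≤ 1 + (1 - n)⁻¹ := by
    intro x hx
    rw [hKd] at hx
    have hx' : x 0 ∈ Ioo (0:ℝ) 1 := hx
    have hp := soloInformed_poleFactor_pos hx' hn
    have hmx := soloInformed_poleFactor_pos hx' hm.2
    have hmx1 : 1 - m * x 0 ^ 2 ≤ 1 := by nlinarith [hm.1, sq_nonneg (x 0)]
    have h := hbd x hx
    rw [abs_of_pos (inv_pos.2 hp)] at h
    rw [abs_of_pos (div_pos hmx hp), div_eq_mul_inv]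
    calc (1 - m * x 0 ^ 2) * (1 - n * x 0 ^ 2)⁻¹ ≤ 1 * (1 - n * x 0 ^ 2)⁻¹ :=
        mul_le_mul_of_nonneg_right hmx1 (inv_pos.2 hp).le
      _ ≤ 1 + (1 - n)⁻¹ := by rw [one_mul]; exact h
  obtain ⟨Q, hQd, hQi⟩ := soloInformed_exists_rep_mul_bounded K _ _ hφ hC
  exact ⟨Q, hQd.trans hKd, fun x => by rw [hQi, hKi]⟩

/-! ### The move -/

/-- **The Kummer involution move**: for `m = 1 − k²`, algebraic `n < 1`, `N = (m−n)/(1−n)`,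
`[(0,1), ((1−n)/(1−m))·(1−mx²)/(1−nx²)·f] − Π_N ∈ relations` by ONE change of variables along
`τ(x) = √(1−x²)/√(1−mx²)`. [this work] -/
theorem soloInformed_kummer_involution_move {k n : ℝ} (hk : k ∈ Ioo (0:ℝ) 1)
    (hka : IsAlgebraic ℚ k) (hn : n < 1) (r r' : IntegralRep 1)
    (hrd : r.domain = {x | x 0 ∈ Ioo (0:ℝ) 1}) (hr'd : r'.domain = {x | x 0 ∈ Ioo (0:ℝ) 1})
    (hri : EqOn r.integrand (fun x => (1 - n) / (1 - (1 - k ^ 2)) *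
      ((1 - (1 - k ^ 2) * x 0 ^ 2) / (1 - n * x 0 ^ 2)) *
      ((√(1 - x 0 ^ 2))⁻¹ * (√(1 - (1 - k ^ 2) * x 0 ^ 2))⁻¹)) r.domain)
    (hr'i : EqOn r'.integrand (fun x => (1 - (1 - k ^ 2 - n) / (1 - n) * x 0 ^ 2)⁻¹ *
      ((√(1 - x 0 ^ 2))⁻¹ * (√(1 - (1 - k ^ 2) * x 0 ^ 2))⁻¹)) r'.domain) :
    of r - of r' ∈ relations := by
  refine changeOfVariablesRel_subset_relations (soloInformed_lift_mem_changeOfVariablesRel r r'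
    (g := fun t : ℝ => √(1 - t ^ 2) / √(1 - (1 - k ^ 2) * t ^ 2))
    (g' := fun t : ℝ => -(k ^ 2 * t) * ((√(1 - t ^ 2))⁻¹ * (√(1 - (1 - k ^ 2) * t ^ 2))⁻¹) /
      (1 - (1 - k ^ 2) * t ^ 2))
    (S := Ioo (0:ℝ) 1) (T := Ioo (0:ℝ) 1) hrd hr'd ?_ (fun t ht => ?_) ?_ ?_ fun x hx => ?_)
  · rw [hrd]
    exact soloInformed_bisection_involution_sa_Ioo hk hka
  · exact soloInformed_bisection_involution_hasDerivAt ht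
  · exact soloInformed_bisection_involution_injOn hk
  · exact soloInformed_bisection_involution_image_Ioo hk
  · have hx1 : x 0 ∈ Ioo (0:ℝ) 1 := by rw [hrd] at hx; exact hx
    have hmem : soloInformedLift (fun t : ℝ => √(1 - t ^ 2) / √(1 - (1 - k ^ 2) * t ^ 2)) x ∈
        r'.domain := by
      rw [hr'd]
      exact soloInformed_bisection_involution_mem_Ioo hk hx1
    rw [hri hx, hr'i hmem]
    simp only [soloInformedLift]
    exact soloInformed_kummer_involution_jacobian hk hx1 hn

/-! ### THEOREM XXVIII(c): the move form, for every algebraic pole parameter `n < 1` -/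

/-- **THEOREM XXVIII(c), move form.** For real algebraic `0 < m < 1`, `n < 1`, `N = (m−n)/(1−n)`
and representations `Π_N = [(0,1), f/(1−Nx²)]`, `Q_n = [(0,1), f(1−mx²)/(1−nx²)]`
(`f = ((1−x²)(1−mx²))^{-1/2}`):  `⟦[pt,1−m]⟧·⟦Π_N⟧ = ⟦[pt,1−n]⟧·⟦Q_n⟧` in `P` — ONE move of
rule (2) along the involution `x ↦ √(1−x²)/√(1−mx²)`, and a scalar. [this work] -/
theorem soloInformed_kummer_involution (m n : ℝ) (hm : m ∈ Ioo (0:ℝ) 1) (hma : IsAlgebraic ℚ m)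
    (hn : n < 1) (hna : IsAlgebraic ℚ n) (PN Q : IntegralRep 1)
    (hPNd : PN.domain = {x | x 0 ∈ Ioo (0:ℝ) 1})
    (hPNi : EqOn PN.integrand (fun x => (1 - (m - n) / (1 - n) * x 0 ^ 2)⁻¹ *
      ((√(1 - x 0 ^ 2))⁻¹ * (√(1 - m * x 0 ^ 2))⁻¹)) PN.domain)
    (hQd : Q.domain = {x | x 0 ∈ Ioo (0:ℝ) 1})
    (hQi : EqOn Q.integrand (fun x => (1 - m * x 0 ^ 2) / (1 - n * x 0 ^ 2) *
      ((√(1 - x 0 ^ 2))⁻¹ * (√(1 - m * x 0 ^ 2))⁻¹)) Q.domain) :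
    toFormalPeriod (of (IntegralRep.unit.constMul (1 - m) (isAlgebraic_one.sub hma))) *
        toFormalPeriod (of PN) =
      toFormalPeriod (of (IntegralRep.unit.constMul (1 - n) (isAlgebraic_one.sub hna))) *
        toFormalPeriod (of Q) := by
  obtain ⟨k, hk, hka, rfl⟩ := soloInformed_exists_complementaryModulus hm hma
  have h1m : IsAlgebraic ℚ (1 - (1 - k ^ 2)) := isAlgebraic_one.sub hma
  have h1n : IsAlgebraic ℚ (1 - n) := isAlgebraic_one.sub hna
  have hk2 : (1:ℝ) - (1 - k ^ 2) ≠ 0 := by nlinarith [hk.1]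
  have hc : IsAlgebraic ℚ ((1 - n) * (1 - (1 - k ^ 2))⁻¹) := h1n.mul h1m.inv
  -- ONE move: `((1−n)/(1−m)) · Q_n ∼ Π_N`
  have hmove : of (Q.constMul _ hc) - of PN ∈ relations :=
    soloInformed_kummer_involution_move hk hka hn _ _ (by rw [IntegralRep.domain_constMul, hQd])
      hPNd (fun x hx => by
        rw [IntegralRep.domain_constMul] at hx
        simp only [IntegralRep.integrand_constMul, hQi hx]
        ring) hPNi
  -- scale by `1 − m`, and compare integrands with `(1 − n) · Q_n`
  have h1 := scale_mem_relations (1 - (1 - k ^ 2)) h1m hmove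
  rw [map_sub, scale_of, scale_of] at h1
  have h2 : of ((Q.constMul _ hc).constMul _ h1m) - of (Q.constMul _ h1n) ∈ relations :=
    of_sub_of_mem_relations_of_eqOn rfl fun x _ => by
      simp only [IntegralRep.integrand_constMul]
      field_simp
  have h3 : of (PN.constMul _ h1m) - of (Q.constMul _ h1n) ∈ relations := by
    have := relations.sub_mem h2 h1
    convert this using 1
    abel
  have h4 := toFormalPeriod_eq_iff.mpr h3
  rwa [toFormalPeriod_of_constMul _ _ PN, toFormalPeriod_of_constMul _ _ Q] at h4

/-- **THEOREM XXVIII(c) in values**: `(1−m)·Π(N | m) = (1−n)·∫₀¹ (1−mx²)dx/((1−nx²)√Δ)`,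
`N = (m−n)/(1−n)`, every real algebraic `n < 1`. [this work] -/
theorem soloInformed_kummer_involution_value (m n : ℝ) (hm : m ∈ Ioo (0:ℝ) 1)
    (hma : IsAlgebraic ℚ m) (hn : n < 1) (hna : IsAlgebraic ℚ n) (PN Q : IntegralRep 1)
    (hPNd : PN.domain = {x | x 0 ∈ Ioo (0:ℝ) 1})
    (hPNi : EqOn PN.integrand (fun x => (1 - (m - n) / (1 - n) * x 0 ^ 2)⁻¹ *
      ((√(1 - x 0 ^ 2))⁻¹ * (√(1 - m * x 0 ^ 2))⁻¹)) PN.domain)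
    (hQd : Q.domain = {x | x 0 ∈ Ioo (0:ℝ) 1})
    (hQi : EqOn Q.integrand (fun x => (1 - m * x 0 ^ 2) / (1 - n * x 0 ^ 2) *
      ((√(1 - x 0 ^ 2))⁻¹ * (√(1 - m * x 0 ^ 2))⁻¹)) Q.domain) :
    (1 - m) * PN.value = (1 - n) * Q.value := by
  have h := congrArg evalP (soloInformed_kummer_involution m n hm hma hn hna PN Q hPNd hPNi hQd
    hQi)
  simpa only [map_mul, evalP_toFormalPeriod_of, IntegralRep.value_constMul,
    IntegralRep.value_unit, mul_one] using h

/-! ### COROLLARY XXVIII.3 — the cusp `n = 0`: `(1−m)·Π(m | m) = E(m)` -/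

/-- **COROLLARY XXVIII.3 (a third-kind period that IS a second-kind one).** For real algebraic
`0 < m < 1`, `Π(m | m) = [(0,1), f/(1−mx²)]` (poles at the branch points `x = ±1/√m`) and
`E(m) = [(0,1), (1−mx²)f]`:  `⟦[pt,1−m]⟧·⟦Π(m | m)⟧ = ⟦E(m)⟧` in `P` — the `n = 0` instance of
THEOREM XXVIII(c), ONE move [AS64, 17.7.24 at `φ = π/2`]. [this work] -/
theorem soloInformed_ellipticPi_branchPole (m : ℝ) (hm : m ∈ Ioo (0:ℝ) 1)
    (hma : IsAlgebraic ℚ m) (P E : IntegralRep 1) (hPd : P.domain = {x | x 0 ∈ Ioo (0:ℝ) 1})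
    (hPi : EqOn P.integrand (fun x => (1 - m * x 0 ^ 2)⁻¹ *
      ((√(1 - x 0 ^ 2))⁻¹ * (√(1 - m * x 0 ^ 2))⁻¹)) P.domain)
    (hEd : E.domain = {x | x 0 ∈ Ioo (0:ℝ) 1})
    (hEi : EqOn E.integrand (fun x => (1 - m * x 0 ^ 2) *
      ((√(1 - x 0 ^ 2))⁻¹ * (√(1 - m * x 0 ^ 2))⁻¹)) E.domain) :
    toFormalPeriod (of (IntegralRep.unit.constMul (1 - m) (isAlgebraic_one.sub hma))) *
      toFormalPeriod (of P) = toFormalPeriod (of E) := by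
  have h := soloInformed_kummer_involution m 0 hm hma one_pos isAlgebraic_zero P E hPd
    (fun x hx => by rw [hPi hx]; simp only [sub_zero, div_one]) hEd
    (fun x hx => by rw [hEi hx]; simp only [zero_mul, sub_zero, div_one])
  rw [h, soloInformed_pointRep_congr (isAlgebraic_one.sub isAlgebraic_zero) isAlgebraic_one
    (sub_zero _), soloInformed_pointRep_one, one_mul]

/-- COROLLARY XXVIII.3 in values: `(1 − m)·Π(m | m) = E(m)`. [this work] -/
theorem soloInformed_ellipticPi_branchPole_value (m : ℝ) (hm : m ∈ Ioo (0:ℝ) 1)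
    (hma : IsAlgebraic ℚ m) (P E : IntegralRep 1) (hPd : P.domain = {x | x 0 ∈ Ioo (0:ℝ) 1})
    (hPi : EqOn P.integrand (fun x => (1 - m * x 0 ^ 2)⁻¹ *
      ((√(1 - x 0 ^ 2))⁻¹ * (√(1 - m * x 0 ^ 2))⁻¹)) P.domain)
    (hEd : E.domain = {x | x 0 ∈ Ioo (0:ℝ) 1})
    (hEi : EqOn E.integrand (fun x => (1 - m * x 0 ^ 2) *
      ((√(1 - x 0 ^ 2))⁻¹ * (√(1 - m * x 0 ^ 2))⁻¹)) E.domain) :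
    (1 - m) * P.value = E.value := by
  have h := congrArg evalP (soloInformed_ellipticPi_branchPole m hm hma P E hPd hPi hEd hEi)
  simpa only [map_mul, evalP_toFormalPeriod_of, IntegralRep.value_constMul,
    IntegralRep.value_unit, mul_one] using h

end Summit.KontsevichZagierPeriods.KontsevichZagierPeriods.Theorems

end
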